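import Mathlib
import HarnessLib
import Summits.HubbardSuperconductivity.HubbardSuperconductivity.Theorems.KLProgrammeKLRegimeEngineFrameShiftResponseDoorCT
import Summits.HubbardSuperconductivity.HubbardSuperconductivity.Theorems.KLProgrammeKLRegimeTwoVolumeFrameMismatchResponse
import Summits.HubbardSuperconductivity.HubbardSuperconductivity.Theorems.KLProgrammeKLRegimeSplitConsts
import Summits.HubbardSuperconductivity.HubbardSuperconductivity.Theorems.KLProgrammeKLRegimeEngineFrameShiftResponseDoorCTMismatch
import Summits.HubbardSuperconductivity.HubbardSuperconductivity.Theorems.KLProgrammeKLRegimeEngineFrameShiftResponseDoorCTPure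

/-!
# K3 gen-8-FLOW (stmt 20437, stub (C), located «(B)-MAIN-UNPRIMED», cure «(B)-MAIN-PURE», step 2): the corrected (B) door in the mismatch-resummed
# representation with the tower input in PURE moments — `norm_iteratedFDeriv_klLocSelfEnergyRe_frame_sub_le_pure` (cell gate-hubbard-kl, seat p2 g22)

Twin of p2 g13's `…EngineFrameShiftResponseDoorCTMismatch.norm_iteratedFDeriv_klLocSelfEnergyRe_frame_sub_le` (door of record, design B-CT) with the ONE
tower input `N` asked in the PURE weight `(|x̃₀|+|x̃₁|)ʲ` (zero at the local vertex for `j ≥ 1`) instead of `(1+|x̃₀|+|x̃₁|)ʲ`; everything else — the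
identity `klLocSelfEnergyRe[K₂] − klLocSelfEnergyRe[K₁] − D∘p = response + dressing`, the shell restriction of the loop labels, the tree jets `A, A′`, the
dressing jets `A_J`, the conclusion `2·(2|β|L²·12·(2N_ω(N₁+N₂)·βL²(200+200B₁)fd/Λ_n²)·N) + (A+A′)/2 + A_J` — VERBATIM; the proof calls
`…ResponseDoorCTPure.covRespCT_readingJet_sub_le_pure` where the original calls `covRespCT_readingJet_sub_le`.  WHY: KL STATUS 2026-08-28 p2 g22
«(B)-MAIN-UNPRIMED» — with the pure weight the MAIN rows `j ≥ 1` of the (B) doors are `O(U³)` (the k-independent tadpole response drops), bookable in the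
(B)-FIT; with the `(1+…)ʲ` weight they are `O(U²)` with coefficient `≥ 2^{32−2j}·Gfr₀/4!`, not bookable against `klC4aJetC2`.

* **`norm_iteratedFDeriv_klLocSelfEnergyRe_frame_sub_le_pure`**.

Proofs only; no definitions; nothing about `N`, `A`, `A′`, `A_J`, `Z` or the sizes of `T_n` is asserted; nothing asserts superconductivity.
References: FST 1996 §1; Salmhofer 1998 §3.1; BGM 2006 §2.3 (2.17), (2.21)–(2.24), §3 (3.3) [cite: BenfattoGiulianiMastropietro2006].
-/

noncomputable section

namespace Summit.HubbardSuperconductivity.HubbardSuperconductivity.Theorems.EngineV8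

set_option linter.dupNamespace false -- summit = problem name (single-conjunct summit), D-0017

open Finset Literature.MathematicalPhysics.QuantumLattice Literature.Probability.LatticeModels GrassmannAlgebra
open Summit.HubbardSuperconductivity.HubbardSuperconductivity.Theorems.KLRegimeSplit
open Summit.HubbardSuperconductivity.HubbardSuperconductivity.Theorems.TwoVolumeDefect
open Summit.HubbardSuperconductivity.HubbardSuperconductivity.Theorems.KLProgrammeLegKernels

variable {L M : ℕ} [NeZero L] [NeZero M]

section Door

variable {β : ℝ} (hβ : 0 < β) (U μ : ℝ) (K₁ K₂ : TrigPolyC4v) (n : ℕ)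
include hβ

/-- **THE CORRECTED (B) DOOR, MISMATCH-RESUMMED, JET FORM.**  For the scale-`n` one-shot actions of one volume at two frames `K₁, K₂` (`D = K₂ ⊖ K₁`,
`|D| ≤ fd ≤ Λ_n/4`), shell counts `N_ω ≥ #{i : |ω_i| < Λ_n}`, `N_j ≥ #{k⃗ : |e_{K_j}| < Λ_n}`, partition functions non-vanishing (frame `K₂`; along
`Ψ_{K₁} + t·d`), the tower input `N` (pinned PURE `(|x̃₀|+|x̃₁|)ʲ`-moments of the four-leg data of `𝒲′[Ψ_{K₁}+t·d]` at the loop strings, loop label ON THE SHELL), the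
tree jets `A, A′` and the dressing jets `A_J` at `q`:
`‖Dʲ[evalM (symInterp L (klLocSelfEnergyRe[K₂] − klLocSelfEnergyRe[K₁] − D∘p))](q)‖ ≤ 2·(2|β|L²·12·(2N_ω(N₁+N₂)·βL²(200+200B₁)fd/Λ_n²)·N) + (A+A′)/2 + A_J`.
[cite: BenfattoGiulianiMastropietro2006, §2.3 (2.21)–(2.24)] -/
theorem norm_iteratedFDeriv_klLocSelfEnergyRe_frame_sub_le_pure
    {B₁ : ℝ} (hB0 : 0 ≤ B₁) (hB : ∀ y, |deriv salmhoferCutoff y| ≤ B₁) (hΛ : 0 < klScale klE0 n)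
    {fd : ℝ} (hfd : fd ≤ klScale klE0 n / 4) (hD : ∀ kv : TorusSite 2 L, |(fsub K₂ K₁).eval (latticeMomentum L kv)| ≤ fd)
    {Nω Nk₁ Nk₂ : ℕ} (hNω : (Finset.univ.filter fun i : MatsubaraIdx M => |matsubaraFreq β M i| < klScale klE0 n).card ≤ Nω)
    (hNk₁ : (Finset.univ.filter fun kv : TorusSite 2 L => |nambuXiCT L μ K₁ kv| < klScale klE0 n).card ≤ Nk₁)
    (hNk₂ : (Finset.univ.filter fun kv : TorusSite 2 L => |nambuXiCT L μ K₂ kv| < klScale klE0 n).card ≤ Nk₂)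
    (hZ₂ : IsUnit (effPartitionFn ℂ (normalCovariance L M (uvSymbolCT L M β μ K₂ (klScale klE0 n)))
      (hubbardInteraction L M β U + counterQuadratic L M β K₂)))
    (hZ : ∀ t ∈ Set.Icc (0 : ℝ) 1, effPartitionFn ℂ
      (normalCovariance L M (uvSymbolCT L M β μ K₁ (klScale klE0 n)) + ((t : ℂ)) •
        (normalCovariance L M (fun ks => uvSymbolCT L M β μ K₂ (klScale klE0 n) ks /
            (1 + uvSymbolCT L M β μ K₂ (klScale klE0 n) ks * (((fsub K₂ K₁).eval (latticeMomentum L ks.1.2) / (β * (L : ℝ) ^ 2) : ℝ) : ℂ))) -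
          normalCovariance L M (uvSymbolCT L M β μ K₁ (klScale klE0 n))))
      (hubbardInteraction L M β U + counterQuadratic L M β K₁) ≠ 0)
    (j : ℕ) (q : Momentum) {N A A' AJ : ℝ} (hN0 : 0 ≤ N) (hA0 : 0 ≤ A) (hA0' : 0 ≤ A')
    (hN : ∀ t ∈ Set.Icc (0 : ℝ) 1, ∀ i ∈ ({omega0 M, (omega0 M).rev} : Finset (MatsubaraIdx M)), ∀ σ : Fin 2, ∀ Al : HubbardFieldIdx L M,
      |matsubaraFreq β M Al.1.1.1| < klScale klE0 n →
      (|nambuXiCT L μ K₁ Al.1.1.2| < klScale klE0 n ∨ |nambuXiCT L μ K₂ Al.1.1.2| < klScale klE0 n) →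
      ∑ x : TorusSite 2 L, (((x 0).valMinAbs.natAbs : ℝ) + ((x 1).valMinAbs.natAbs : ℝ)) ^ j * ‖torusFourierInv (fun kv : TorusSite 2 L =>
        kernel ℂ (effAction ℂ (normalCovariance L M (uvSymbolCT L M β μ K₁ (klScale klE0 n)) + ((t : ℂ)) •
          (normalCovariance L M (fun ks => uvSymbolCT L M β μ K₂ (klScale klE0 n) ks /
              (1 + uvSymbolCT L M β μ K₂ (klScale klE0 n) ks * (((fsub K₂ K₁).eval (latticeMomentum L ks.1.2) / (β * (L : ℝ) ^ 2) : ℝ) : ℂ))) -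
            normalCovariance L M (uvSymbolCT L M β μ K₁ (klScale klE0 n))))
          (hubbardInteraction L M β U + counterQuadratic L M β K₁)) 4
          (Fin.snoc (Fin.snoc ![((((i, kv), σ), 0) : HubbardFieldIdx L M), (((i, kv), σ), 1)] (Al.1, 1 - Al.2) : Fin 3 → HubbardFieldIdx L M) Al)) x‖ ≤ N)
    (hT : ∀ t ∈ Set.Icc (0 : ℝ) 1,
      ‖iteratedFDeriv ℝ j (evalM (symInterp L (fun kv : TorusSite 2 L => ((∑ σ : Fin 2,
        (selfEnergy L M β (grassmannDerivPairing ℂ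
            (normalCovariance L M (fun ks => uvSymbolCT L M β μ K₂ (klScale klE0 n) ks /
                (1 + uvSymbolCT L M β μ K₂ (klScale klE0 n) ks * (((fsub K₂ K₁).eval (latticeMomentum L ks.1.2) / (β * (L : ℝ) ^ 2) : ℝ) : ℂ))) -
              normalCovariance L M (uvSymbolCT L M β μ K₁ (klScale klE0 n)))
            (effAction ℂ (normalCovariance L M (uvSymbolCT L M β μ K₁ (klScale klE0 n)) + ((t : ℂ)) •
              (normalCovariance L M (fun ks => uvSymbolCT L M β μ K₂ (klScale klE0 n) ks /
                  (1 + uvSymbolCT L M β μ K₂ (klScale klE0 n) ks * (((fsub K₂ K₁).eval (latticeMomentum L ks.1.2) / (β * (L : ℝ) ^ 2) : ℝ) : ℂ))) -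
                normalCovariance L M (uvSymbolCT L M β μ K₁ (klScale klE0 n))))
              (hubbardInteraction L M β U + counterQuadratic L M β K₁))
            (effAction ℂ (normalCovariance L M (uvSymbolCT L M β μ K₁ (klScale klE0 n)) + ((t : ℂ)) •
              (normalCovariance L M (fun ks => uvSymbolCT L M β μ K₂ (klScale klE0 n) ks /
                  (1 + uvSymbolCT L M β μ K₂ (klScale klE0 n) ks * (((fsub K₂ K₁).eval (latticeMomentum L ks.1.2) / (β * (L : ℝ) ^ 2) : ℝ) : ℂ))) -
                normalCovariance L M (uvSymbolCT L M β μ K₁ (klScale klE0 n))))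
              (hubbardInteraction L M β U + counterQuadratic L M β K₁))) (omega0 M, kv) σ +
          selfEnergy L M β (grassmannDerivPairing ℂ
            (normalCovariance L M (fun ks => uvSymbolCT L M β μ K₂ (klScale klE0 n) ks /
                (1 + uvSymbolCT L M β μ K₂ (klScale klE0 n) ks * (((fsub K₂ K₁).eval (latticeMomentum L ks.1.2) / (β * (L : ℝ) ^ 2) : ℝ) : ℂ))) -
              normalCovariance L M (uvSymbolCT L M β μ K₁ (klScale klE0 n)))
            (effAction ℂ (normalCovariance L M (uvSymbolCT L M β μ K₁ (klScale klE0 n)) + ((t : ℂ)) •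
              (normalCovariance L M (fun ks => uvSymbolCT L M β μ K₂ (klScale klE0 n) ks /
                  (1 + uvSymbolCT L M β μ K₂ (klScale klE0 n) ks * (((fsub K₂ K₁).eval (latticeMomentum L ks.1.2) / (β * (L : ℝ) ^ 2) : ℝ) : ℂ))) -
                normalCovariance L M (uvSymbolCT L M β μ K₁ (klScale klE0 n))))
              (hubbardInteraction L M β U + counterQuadratic L M β K₁))
            (effAction ℂ (normalCovariance L M (uvSymbolCT L M β μ K₁ (klScale klE0 n)) + ((t : ℂ)) •
              (normalCovariance L M (fun ks => uvSymbolCT L M β μ K₂ (klScale klE0 n) ks /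
                  (1 + uvSymbolCT L M β μ K₂ (klScale klE0 n) ks * (((fsub K₂ K₁).eval (latticeMomentum L ks.1.2) / (β * (L : ℝ) ^ 2) : ℝ) : ℂ))) -
                normalCovariance L M (uvSymbolCT L M β μ K₁ (klScale klE0 n))))
              (hubbardInteraction L M β U + counterQuadratic L M β K₁))) ((omega0 M).rev, kv) σ)) / 4).re))) q‖ ≤ A ∧
      ‖iteratedFDeriv ℝ j (evalM (symInterp L (fun kv : TorusSite 2 L => ((∑ σ : Fin 2,
        (selfEnergy L M β (grassmannDerivPairing ℂ
            (normalCovariance L M (fun ks => uvSymbolCT L M β μ K₂ (klScale klE0 n) ks /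
                (1 + uvSymbolCT L M β μ K₂ (klScale klE0 n) ks * (((fsub K₂ K₁).eval (latticeMomentum L ks.1.2) / (β * (L : ℝ) ^ 2) : ℝ) : ℂ))) -
              normalCovariance L M (uvSymbolCT L M β μ K₁ (klScale klE0 n)))
            (effAction ℂ (normalCovariance L M (uvSymbolCT L M β μ K₁ (klScale klE0 n)) + ((t : ℂ)) •
              (normalCovariance L M (fun ks => uvSymbolCT L M β μ K₂ (klScale klE0 n) ks /
                  (1 + uvSymbolCT L M β μ K₂ (klScale klE0 n) ks * (((fsub K₂ K₁).eval (latticeMomentum L ks.1.2) / (β * (L : ℝ) ^ 2) : ℝ) : ℂ))) -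
                normalCovariance L M (uvSymbolCT L M β μ K₁ (klScale klE0 n))))
              (hubbardInteraction L M β U + counterQuadratic L M β K₁))
            (effAction ℂ (normalCovariance L M (uvSymbolCT L M β μ K₁ (klScale klE0 n)) + ((t : ℂ)) •
              (normalCovariance L M (fun ks => uvSymbolCT L M β μ K₂ (klScale klE0 n) ks /
                  (1 + uvSymbolCT L M β μ K₂ (klScale klE0 n) ks * (((fsub K₂ K₁).eval (latticeMomentum L ks.1.2) / (β * (L : ℝ) ^ 2) : ℝ) : ℂ))) -
                normalCovariance L M (uvSymbolCT L M β μ K₁ (klScale klE0 n))))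
              (hubbardInteraction L M β U + counterQuadratic L M β K₁))) (omega0 M, kv) σ +
          selfEnergy L M β (grassmannDerivPairing ℂ
            (normalCovariance L M (fun ks => uvSymbolCT L M β μ K₂ (klScale klE0 n) ks /
                (1 + uvSymbolCT L M β μ K₂ (klScale klE0 n) ks * (((fsub K₂ K₁).eval (latticeMomentum L ks.1.2) / (β * (L : ℝ) ^ 2) : ℝ) : ℂ))) -
              normalCovariance L M (uvSymbolCT L M β μ K₁ (klScale klE0 n)))
            (effAction ℂ (normalCovariance L M (uvSymbolCT L M β μ K₁ (klScale klE0 n)) + ((t : ℂ)) •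
              (normalCovariance L M (fun ks => uvSymbolCT L M β μ K₂ (klScale klE0 n) ks /
                  (1 + uvSymbolCT L M β μ K₂ (klScale klE0 n) ks * (((fsub K₂ K₁).eval (latticeMomentum L ks.1.2) / (β * (L : ℝ) ^ 2) : ℝ) : ℂ))) -
                normalCovariance L M (uvSymbolCT L M β μ K₁ (klScale klE0 n))))
              (hubbardInteraction L M β U + counterQuadratic L M β K₁))
            (effAction ℂ (normalCovariance L M (uvSymbolCT L M β μ K₁ (klScale klE0 n)) + ((t : ℂ)) •
              (normalCovariance L M (fun ks => uvSymbolCT L M β μ K₂ (klScale klE0 n) ks /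
                  (1 + uvSymbolCT L M β μ K₂ (klScale klE0 n) ks * (((fsub K₂ K₁).eval (latticeMomentum L ks.1.2) / (β * (L : ℝ) ^ 2) : ℝ) : ℂ))) -
                normalCovariance L M (uvSymbolCT L M β μ K₁ (klScale klE0 n))))
              (hubbardInteraction L M β U + counterQuadratic L M β K₁))) ((omega0 M).rev, kv) σ)) / 4).im))) q‖ ≤ A')
    (hJ : ‖iteratedFDeriv ℝ j (evalM (symInterp L (fun kv : TorusSite 2 L =>
        (∑ σ : Fin 2, ∑ i ∈ ({omega0 M, (omega0 M).rev} : Finset (MatsubaraIdx M)),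
          (-(((β * (L : ℝ) ^ 2 : ℝ) : ℂ) * (((fsub K₂ K₁).eval (latticeMomentum L kv) / (β * (L : ℝ) ^ 2) : ℝ) : ℂ) ^ 2 *
              (uvSymbolCT L M β μ K₂ (klScale klE0 n) ((i, kv), σ) /
                (1 + uvSymbolCT L M β μ K₂ (klScale klE0 n) ((i, kv), σ) * (((fsub K₂ K₁).eval (latticeMomentum L kv) / (β * (L : ℝ) ^ 2) : ℝ) : ℂ)))) +
            ((1 - (((fsub K₂ K₁).eval (latticeMomentum L kv) / (β * (L : ℝ) ^ 2) : ℝ) : ℂ) *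
                (uvSymbolCT L M β μ K₂ (klScale klE0 n) ((i, kv), σ) /
                  (1 + uvSymbolCT L M β μ K₂ (klScale klE0 n) ((i, kv), σ) * (((fsub K₂ K₁).eval (latticeMomentum L kv) / (β * (L : ℝ) ^ 2) : ℝ) : ℂ)))) ^ 2 -
                1) *
              selfEnergy L M β (effAction ℂ (normalCovariance L M fun ks =>
                uvSymbolCT L M β μ K₂ (klScale klE0 n) ks /
                  (1 + uvSymbolCT L M β μ K₂ (klScale klE0 n) ks * (((fsub K₂ K₁).eval (latticeMomentum L ks.1.2) / (β * (L : ℝ) ^ 2) : ℝ) : ℂ)))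
              (hubbardInteraction L M β U + counterQuadratic L M β K₁)) (i, kv) σ).re) / 4))) q‖ ≤ AJ) :
    ‖iteratedFDeriv ℝ j (evalM (symInterp L (fun kv : TorusSite 2 L =>
        klLocSelfEnergyRe L M β U μ K₂ n kv - klLocSelfEnergyRe L M β U μ K₁ n kv - (fsub K₂ K₁).eval (latticeMomentum L kv)))) q‖ ≤
      2 * (2 * (|β| * (L : ℝ) ^ 2) * (12 * (2 * (Nω : ℝ) * ((Nk₁ : ℝ) + Nk₂) *
        (β * (L : ℝ) ^ 2 * (200 + 200 * B₁) / klScale klE0 n ^ 2 * fd)) * N)) + (A + A') / 2 + AJ := by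
  have hL : (0 : ℝ) < L := by exact_mod_cast NeZero.pos L
  -- the partition function at frame `K₁` (t = 0 of the line)
  have hZ₁ : IsUnit (effPartitionFn ℂ (normalCovariance L M (uvSymbolCT L M β μ K₁ (klScale klE0 n)))
      (hubbardInteraction L M β U + counterQuadratic L M β K₁)) := by
    have h0 := hZ 0 ⟨le_rfl, zero_le_one⟩
    rw [Complex.ofReal_zero, zero_smul, add_zero] at h0
    exact isUnit_iff_ne_zero.2 h0
  -- the entry sum by the shell count (before abbreviating)
  have hsum := sum_norm_mismatchDefect_le_shell hβ μ K₁ K₂ (klScale klE0 n) hB0 hB hΛ hfd hD hNω hNk₁ hNk₂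
  -- split the data: response + dressing
  rw [klLocSelfEnergyRe_sub_sub_eval_eq hβ U μ K₁ K₂ n hZ₂ hZ₁]
  -- abbreviations (fold everywhere)
  set s₀ : FreqMomentum L M × Fin 2 → ℂ := uvSymbolCT L M β μ K₁ (klScale klE0 n) with hs₀
  set s₁ : FreqMomentum L M × Fin 2 → ℂ := fun ks => uvSymbolCT L M β μ K₂ (klScale klE0 n) ks /
      (1 + uvSymbolCT L M β μ K₂ (klScale klE0 n) ks * (((fsub K₂ K₁).eval (latticeMomentum L ks.1.2) / (β * (L : ℝ) ^ 2) : ℝ) : ℂ)) with hs₁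
  rw [evalM_symInterp_add]
  have hc : ∀ f : TorusSite 2 L → ℝ, ContDiff ℝ j (evalM (symInterp L f)) := fun f => (contDiff_evalM _).of_le le_top
  rw [fun_iteratedFDeriv_add_apply (hc _).contDiffAt (hc _).contDiffAt]
  refine (norm_add_le _ _).trans (add_le_add ?_ hJ)
  -- the response part: the per-functional door with the support-restricted tower input
  have hsupp : ∀ t ∈ Set.Icc (0 : ℝ) 1, ∀ i ∈ ({omega0 M, (omega0 M).rev} : Finset (MatsubaraIdx M)), ∀ σ : Fin 2, ∀ Al : HubbardFieldIdx L M,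
      s₁ Al.1 - s₀ Al.1 ≠ 0 →
      ∑ x : TorusSite 2 L, (((x 0).valMinAbs.natAbs : ℝ) + ((x 1).valMinAbs.natAbs : ℝ)) ^ j * ‖torusFourierInv (fun kv : TorusSite 2 L =>
        kernel ℂ (effAction ℂ (normalCovariance L M s₀ + ((t : ℂ)) • (normalCovariance L M s₁ - normalCovariance L M s₀))
          (hubbardInteraction L M β U + counterQuadratic L M β K₁)) 4
          (Fin.snoc (Fin.snoc ![((((i, kv), σ), 0) : HubbardFieldIdx L M), (((i, kv), σ), 1)] (Al.1, 1 - Al.2) : Fin 3 → HubbardFieldIdx L M) Al)) x‖ ≤ N := by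
    intro t ht i hi σ Al hAl
    obtain ⟨⟨⟨ia, ka⟩, τ⟩, c⟩ := Al
    have hsq : ∀ {x : ℝ}, klScale klE0 n ≤ |x| → klScale klE0 n ^ 2 ≤ x ^ 2 := fun {x} h1 => by
      calc klScale klE0 n ^ 2 ≤ |x| ^ 2 := by gcongr
        _ = x ^ 2 := sq_abs _
    by_cases hω : |matsubaraFreq β M ia| < klScale klE0 n
    · by_cases he : |nambuXiCT L μ K₁ ka| < klScale klE0 n ∨ |nambuXiCT L μ K₂ ka| < klScale klE0 n
      · exact hN t ht i hi σ _ hω he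
      · exfalso
        push Not at he
        refine hAl ?_
        show s₁ ((ia, ka), τ) - s₀ ((ia, ka), τ) = 0
        exact mismatchDefect_eq_zero_of_ge hβ μ K₁ K₂ (klScale klE0 n) hΛ ia ka τ
          ((hsq he.2).trans (le_add_of_nonneg_left (sq_nonneg _))) ((hsq he.1).trans (le_add_of_nonneg_left (sq_nonneg _)))
    · exfalso
      refine hAl ?_
      show s₁ ((ia, ka), τ) - s₀ ((ia, ka), τ) = 0
      exact mismatchDefect_eq_zero_of_freq_ge hβ μ K₁ K₂ (klScale klE0 n) hΛ ia ka τ (not_lt.1 hω)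
  have hdoor := covRespCT_readingJet_sub_le_pure s₀ s₁ β U K₁ (omega0 M) (omega0 M).rev j q hZ hN0 hA0 hA0' hsupp hT
  refine hdoor.trans ?_
  have hfd0 : 0 ≤ fd := (abs_nonneg _).trans (hD 0)
  gcongr

end Door

end Summit.HubbardSuperconductivity.HubbardSuperconductivity.Theorems.EngineV8

end
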